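import Mathlib
import HarnessLib

/-!
# Chain independence of the generators modulo `p`-th powers

Crux `IndSmooth.ValuativeSmoothing` (stmt-ResolutionOfSingularities-16087), line `birth`,
devissage programme "discrete jumps", stub E1 `valuation_monomial_ne_of_chain`.

## Setting

A valuation subring `Os 0` of a field `K` whose value group has only *discrete jumps* is
described by a chain of valuation subrings `Os 0 ≤ Os 1 ≤ ⋯ ≤ Os N` of `K` together with
elements `e i ∈ Os i.castSucc` such that

* the maximal ideal of `Os i.castSucc` is principal, generated by `e i` (`hmax`);
* `Os i.succ` is the localisation `(Os i.castSucc)[1 / e i]` (`hloc`).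

## Main result

* `valuation_monomial_ne_of_chain`: for exponent vectors `α ≠ β : Fin N → Fin p` and any
  `h : K`, the `Os 0`-valuations of `∏ i, e i ^ α i` and `h ^ p * ∏ i, e i ^ β i` differ.
  In words: the values of the monomials `e ^ α` with exponents `< p` are pairwise
  incongruent modulo values of `p`-th powers.

## Proof

Suppose the two valuations agree.  Equal `Os 0`-valuations differ by a unit of `Os 0`, which
is a unit of every larger ring of the chain, so the valuations also agree for the valuation
`v` of `R := Os i₀.castSucc`, where `i₀` is the *largest* index with `α i₀ ≠ β i₀`.  For
`i < i₀` the element `e i` is a unit of `R` (it is inverted in `Os i.succ ≤ R`), so it has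
`v`-value `1`; for `i > i₀` the exponents agree.  Cancelling the common nonzero factor leaves
`v ε ^ a = v h ^ p * v ε ^ b` with `ε := e i₀`, `a := α i₀ ≠ b := β i₀`, both `< p`.
Since `ε` generates the maximal ideal of `R`, `v ε` is the largest value `< 1`, and an
elementary inequality argument in the value group (`pow_valuation_ne_pow`) shows that
`v ε ^ d` is never a `p`-th power `v h ^ p` for `0 < d < p`; applying this to `h`
(if `a > b`) or to `h⁻¹` (if `a < b`) gives the contradiction.  Primality of `p` is not
needed for this statement.
-/

-- single-problem summit: the doubled namespace component is forced
set_option linter.dupNamespace false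

open scoped TensorProduct

namespace Summit.ResolutionOfSingularities.ResolutionOfSingularities.Theorems.ValuativeSmoothing

namespace ChainIndependence

variable {K : Type} [Field K]

/-- An element of a valuation subring with an inverse in the subring has valuation `1`. -/
theorem valuation_eq_one_of_mul_eq_one (A : ValuationSubring K) {x y : K} (hx : x ∈ A)
    (hy : y ∈ A) (hxy : x * y = 1) : A.valuation x = 1 :=
  (A.valuation_eq_one_iff ⟨x, hx⟩).mp (IsUnit.of_mul_eq_one ⟨y, hy⟩ (Subtype.ext hxy))

/-- Equality of valuations transfers from a valuation subring to any overring: the two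
elements differ by a unit of the small ring, which stays a unit in the big one. -/
theorem valuation_eq_of_le {A B : ValuationSubring K} (hAB : A ≤ B) {x y : K}
    (hxy : A.valuation x = A.valuation y) : B.valuation x = B.valuation y := by
  obtain ⟨u, hu⟩ := (A.valuation_eq_iff x y).mp hxy
  have hu1 : B.valuation ((u : A) : K) = 1 := by
    refine valuation_eq_one_of_mul_eq_one B (hAB (u : A).2) (hAB (↑u⁻¹ : A).2) ?_
    exact congrArg Subtype.val u.mul_inv
  rw [← hu, map_mul, hu1, one_mul]

/-- In a valuation subring whose maximal ideal is generated by `ε`, every element of `K` of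
valuation `< 1` has valuation at most the valuation of `ε`. -/
theorem valuation_le_of_lt_one (A : ValuationSubring K) {ε : K} (hε : ε ∈ A)
    (hmax : IsLocalRing.maximalIdeal A = Ideal.span {(⟨ε, hε⟩ : A)}) {z : K}
    (hz : A.valuation z < 1) : A.valuation z ≤ A.valuation ε := by
  have hzA : z ∈ A := A.mem_of_valuation_le_one z hz.le
  have hzm : (⟨z, hzA⟩ : A) ∈ IsLocalRing.maximalIdeal A := (A.valuation_lt_one_iff _).mpr hz
  rw [hmax, Ideal.mem_span_singleton'] at hzm
  obtain ⟨a, ha⟩ := hzm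
  have haz : (a : K) * ε = z := congrArg Subtype.val ha
  calc A.valuation z = A.valuation a * A.valuation ε := by rw [← haz, map_mul]
    _ ≤ A.valuation ε := mul_le_of_le_one_left' (A.valuation_le_one a)

/-- Core inequality: if `ε ≠ 0` generates the maximal ideal of `A`, then `v ε ^ d` is not of
the form `v h ^ p` for `0 < d < p` (`v` the valuation of `A`). -/
theorem pow_valuation_ne_pow (A : ValuationSubring K) {ε : K} (hε : ε ∈ A) (hε0 : ε ≠ 0)
    (hmax : IsLocalRing.maximalIdeal A = Ideal.span {(⟨ε, hε⟩ : A)}) {p d : ℕ} (hd : 0 < d)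
    (hdp : d < p) (h : K) : A.valuation ε ^ d ≠ A.valuation h ^ p := by
  intro H
  have hε1 : A.valuation ε < 1 :=
    (A.valuation_lt_one_iff ⟨ε, hε⟩).mp (hmax ▸ Ideal.mem_span_singleton_self _)
  have hεpos : 0 < A.valuation ε := ((map_ne_zero A.valuation).mpr hε0).pos
  have hpd : A.valuation ε ^ p < A.valuation ε ^ d :=
    pow_lt_pow_right_of_lt_one₀ hεpos hε1 hdp
  have hd1 : A.valuation ε ^ d < 1 := pow_lt_one₀ hεpos.le hε1 hd.ne'
  have hh1 : A.valuation h < 1 := by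
    by_contra hcon
    have h1p : 1 ≤ A.valuation h ^ p := one_le_pow₀ (not_lt.mp hcon)
    exact h1p.not_gt (H ▸ hd1)
  have hhε : A.valuation h ≤ A.valuation ε := valuation_le_of_lt_one A hε hmax hh1
  have hp : A.valuation h ^ p ≤ A.valuation ε ^ p := pow_le_pow_left₀ zero_le hhε p
  exact (hp.trans_lt hpd).ne' H

/-- Exponent bookkeeping on top of `pow_valuation_ne_pow`: a relation
`v ε ^ a = v h ^ p * v ε ^ b` with `a ≠ b` both `< p` is impossible. -/
theorem false_of_pow_valuation_eq (A : ValuationSubring K) {ε : K} (hε : ε ∈ A)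
    (hε0 : ε ≠ 0) (hmax : IsLocalRing.maximalIdeal A = Ideal.span {(⟨ε, hε⟩ : A)})
    {p a b : ℕ} (ha : a < p) (hb : b < p) (hab : a ≠ b) (h : K)
    (H : A.valuation ε ^ a = A.valuation h ^ p * A.valuation ε ^ b) : False := by
  have ht0 : A.valuation ε ≠ 0 := (map_ne_zero A.valuation).mpr hε0
  rcases lt_or_gt_of_ne hab with hlt | hlt
  · -- `a < b`: apply the core inequality to `h⁻¹` and `d = b - a`.
    have h1 : A.valuation h ^ p * A.valuation ε ^ (b - a) = 1 := by
      apply mul_right_cancel₀ (pow_ne_zero a ht0)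
      rw [one_mul, mul_assoc, ← pow_add, Nat.sub_add_cancel hlt.le, ← H]
    have h2 : A.valuation ε ^ (b - a) = A.valuation h⁻¹ ^ p := by
      rw [map_inv₀, inv_pow]
      exact eq_inv_of_mul_eq_one_right h1
    exact pow_valuation_ne_pow A hε hε0 hmax (Nat.sub_pos_of_lt hlt) (by omega) h⁻¹ h2
  · -- `b < a`: apply the core inequality to `h` and `d = a - b`.
    have h2 : A.valuation ε ^ (a - b) = A.valuation h ^ p := by
      apply mul_right_cancel₀ (pow_ne_zero b ht0)
      rw [← pow_add, Nat.sub_add_cancel hlt.le, H]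
    exact pow_valuation_ne_pow A hε hε0 hmax (Nat.sub_pos_of_lt hlt) (by omega) h h2

/-- The chain `Os` is monotone: `Os i.succ = (Os i.castSucc)[1 / e i]` contains
`Os i.castSucc`. -/
theorem chain_monotone (N : ℕ) (Os : Fin (N + 1) → ValuationSubring K) (e : Fin N → K)
    (hloc : ∀ (i : Fin N) (x : K), x ∈ Os i.succ ↔ ∃ n : ℕ, e i ^ n * x ∈ Os i.castSucc) :
    Monotone Os :=
  Fin.monotone_iff_le_succ.mpr fun i x hx => (hloc i x).mpr ⟨0, by simpa using hx⟩

/-- The generator `e i` becomes a unit further up the chain: its valuation with respect to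
`Os j` is `1` as soon as `i.succ ≤ j`. -/
theorem chain_valuation_eq_one (N : ℕ) (Os : Fin (N + 1) → ValuationSubring K)
    (e : Fin N → K) (he : ∀ i : Fin N, e i ∈ Os i.castSucc) (he0 : ∀ i : Fin N, e i ≠ 0)
    (hloc : ∀ (i : Fin N) (x : K), x ∈ Os i.succ ↔ ∃ n : ℕ, e i ^ n * x ∈ Os i.castSucc)
    (i : Fin N) (j : Fin (N + 1)) (hij : i.succ ≤ j) : (Os j).valuation (e i) = 1 := by
  have hmono := chain_monotone N Os e hloc
  refine valuation_eq_one_of_mul_eq_one (Os j) ?_ ?_ (mul_inv_cancel₀ (he0 i))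
  · exact hmono (i.castSucc_lt_succ.le.trans hij) (he i)
  · refine hmono hij ((hloc i _).mpr ⟨1, ?_⟩)
    rw [pow_one, mul_inv_cancel₀ (he0 i)]
    exact one_mem _

end ChainIndependence

/-- Stub E1: valuation independence of the chain generators modulo `p`-th powers. -/
theorem valuation_monomial_ne_of_chain (p : ℕ) [Fact p.Prime] (K : Type) [Field K]
    (N : ℕ) (Os : Fin (N + 1) → ValuationSubring K) (e : Fin N → K)
    (he : ∀ i : Fin N, e i ∈ Os i.castSucc) (he0 : ∀ i : Fin N, e i ≠ 0)
    (hmax : ∀ i : Fin N,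
      IsLocalRing.maximalIdeal (Os i.castSucc) = Ideal.span {(⟨e i, he i⟩ : Os i.castSucc)})
    (hloc : ∀ (i : Fin N) (x : K), x ∈ Os i.succ ↔ ∃ n : ℕ, e i ^ n * x ∈ Os i.castSucc)
    (α β : Fin N → Fin p) (hαβ : α ≠ β) (h : K) :
    (Os 0).valuation (∏ i, e i ^ (α i : ℕ)) ≠
      (Os 0).valuation (h ^ p * ∏ i, e i ^ (β i : ℕ)) := by
  classical
  have _hp : p.Prime := Fact.out
  intro H
  -- the largest index at which the exponent vectors differ
  obtain ⟨i₀, hi₀, hgt⟩ : ∃ i₀, α i₀ ≠ β i₀ ∧ ∀ i, i₀ < i → α i = β i := by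
    obtain ⟨j, hj⟩ : ∃ j, α j ≠ β j := Function.ne_iff.mp hαβ
    let S : Finset (Fin N) := Finset.univ.filter fun i => α i ≠ β i
    have hSne : S.Nonempty := ⟨j, by simp [S, hj]⟩
    refine ⟨S.max' hSne, ?_, fun i hi => ?_⟩
    · have hmem := S.max'_mem hSne
      simpa [S] using hmem
    · by_contra hne
      exact (not_le.mpr hi) (S.le_max' i (by simp [S, hne]))
  have hmono : Monotone Os := ChainIndependence.chain_monotone N Os e hloc
  -- transfer the equality of valuations to `R := Os i₀.castSucc`
  have hle : Os 0 ≤ Os i₀.castSucc := hmono (Fin.zero_le _)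
  have H1 := ChainIndependence.valuation_eq_of_le hle H
  simp only [map_mul, map_prod, map_pow] at H1
  -- split off the factor at `i₀`; the remaining factors agree
  rw [← Finset.mul_prod_erase Finset.univ
      (fun i => (Os i₀.castSucc).valuation (e i) ^ (α i : ℕ)) (Finset.mem_univ i₀),
    ← Finset.mul_prod_erase Finset.univ
      (fun i => (Os i₀.castSucc).valuation (e i) ^ (β i : ℕ)) (Finset.mem_univ i₀)] at H1
  have hrest : ∏ i ∈ Finset.univ.erase i₀, (Os i₀.castSucc).valuation (e i) ^ (β i : ℕ) =
      ∏ i ∈ Finset.univ.erase i₀, (Os i₀.castSucc).valuation (e i) ^ (α i : ℕ) := by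
    refine Finset.prod_congr rfl fun i hi => ?_
    rcases lt_or_gt_of_ne (Finset.ne_of_mem_erase hi) with hlt | hlt
    · rw [ChainIndependence.chain_valuation_eq_one N Os e he he0 hloc i i₀.castSucc
        (Fin.succ_le_castSucc_iff.mpr hlt), one_pow, one_pow]
    · rw [hgt i hlt]
  have hD : ∏ i ∈ Finset.univ.erase i₀, (Os i₀.castSucc).valuation (e i) ^ (α i : ℕ) ≠ 0 :=
    Finset.prod_ne_zero_iff.mpr fun i _ =>
      pow_ne_zero _ ((map_ne_zero (Os i₀.castSucc).valuation).mpr (he0 i))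
  rw [hrest, ← mul_assoc] at H1
  exact ChainIndependence.false_of_pow_valuation_eq (Os i₀.castSucc) (he i₀) (he0 i₀) (hmax i₀)
    (α i₀).isLt (β i₀).isLt (Fin.val_ne_of_ne hi₀) h (mul_right_cancel₀ hD H1)

end Summit.ResolutionOfSingularities.ResolutionOfSingularities.Theorems.ValuativeSmoothing
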